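import Summits.ValiantsHypothesis.ValiantsHypothesis.Theorems.SymPencilPerFourCrossFilter

/-!
# Route `SymPencil` — the CROSS branch of the size-`27` cell `(9, 7, 8)` is empty: the full cross
# `X_{lc}` carries no per-direction family of `< 9` squares (`--supports`
# stmt-ValiantsHypothesis-5674 `SdcSuperquadratic`; rung currency only, nothing here bears on `VP ≠ VNP`)

By `SymPencilBoxFourSeven.seven_trichotomy` a `7`-dimensional `V ⊆ Sing Z(per₄)` has a detecting
pair of rows, or of columns, or lies in (hence equals) a cross `X_{lc}`.  In the cell
`(r, dim V, d) = (9, 7, 8)` of the size-`27` kernel-package table the kernel space carries a joint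
family of `8` squares, in particular a per-direction family of `8 < 9` squares.

**Theorem** (`false_of_cross_seven_of_sum_sq_swap`).  Over a field of characteristic `0`, a
`7`-dimensional `V` supported in a cross `X_{lc}` does not admit, for every `y ∈ V`, a family of
`< 9` squares for the `s²`-coefficient of `per_4 (u + s y)`.  Proof: `V = X_{lc}` by dimension; the
Kronecker form (`SymPencilPerFourCrossKronecker.prod_arms_eq_zero_on`, after moving the cross to
`(3,3)`) makes the product of the six arm coordinates vanish on `V`, so one arm coordinate vanishes
identically (`SymPencilPerFourPairingHyperplane.exists_forall_eq_zero_of_prod_eq_zero`) — but the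
full cross contains the corresponding unit matrix.

So the cross branch of `(9,7,8)` is dead with NO inner-rank input; the detecting-pair branches remain
(memo `Cruxes/SdcSuperquadratic/CELLS-27.md`).  Honest framing: a branch of one cell; `27 ≤ sdc(per₄)
≤ 29` unchanged, stmt-5674 open, `VP ≠ VNP` not moved, no summit statement is proved here.  No
definitions, no named facts. [folklore]
-/

noncomputable section

-- single-conjunct layout: Sub = Summit, duplicated namespace component intended
set_option linter.dupNamespace false

namespace Summit.ValiantsHypothesis.ValiantsHypothesis.Theorems.SymPencilPerFourCrossSevenEight

open Matrix MvPolynomial Finset Module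
open Literature.Computability.AlgebraicComplexity
open Summit.ValiantsHypothesis.ValiantsHypothesis.Theorems.SymPencilPerFourBlocks
open Summit.ValiantsHypothesis.ValiantsHypothesis.Theorems.SymPencilPerFourCrossKronecker
open Summit.ValiantsHypothesis.ValiantsHypothesis.Theorems.SymPencilPerFourSixDimCross
open Summit.ValiantsHypothesis.ValiantsHypothesis.Theorems.SymPencilPerFourPairingHyperplane
open Summit.ValiantsHypothesis.ValiantsHypothesis.Theorems.SymPencilPerFourLowRankSeven

variable {K : Type*} [Field K]

/-- **The cross `X₃₃` (dimension `7`) carries no per-direction family of `< 9` squares.**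
[folklore] -/
theorem false_of_cross33_seven_of_sum_sq_swap [CharZero K] {ι : Type*} [Fintype ι]
    (hι : Fintype.card ι < 9) (V : Submodule K (Fin 4 × Fin 4 → K))
    (hX : ∀ x ∈ V, ∀ i j : Fin 4, i ≠ 3 → j ≠ 3 → x (i, j) = 0) (h7 : finrank K V = 7)
    (hW : ∀ y ∈ V, ∃ (c : ι → K) (Λ : ι → ((Fin 4 × Fin 4 → K) →ₗ[K] K)),
      ∀ u : Fin 4 × Fin 4 → K, ∃ e₀ e₁ : K, ∀ s : K,
        eval (u + s • y) (perPoly (Fin 4) K) = e₀ + s * e₁ + s ^ 2 * ∑ k, c k * (Λ k u) ^ 2) :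
    False := by
  classical
  -- the product of the six arm coordinates vanishes on `V`
  let f : Fin 3 ⊕ Fin 3 → ((Fin 4 × Fin 4 → K) →ₗ[K] K) := fun t =>
    Sum.elim (fun k => LinearMap.proj ((3 : Fin 4), (Fin.castSucc k : Fin 4)))
      (fun k => LinearMap.proj ((Fin.castSucc k : Fin 4), (3 : Fin 4))) t
  have hprod : ∀ y ∈ V, ∏ t ∈ (Finset.univ : Finset (Fin 3 ⊕ Fin 3)), f t y = 0 := by
    intro y hy
    have h := prod_arms_eq_zero_on hι V hX hW y hy
    rw [Fintype.prod_sum_type]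
    simp only [f, Sum.elim_inl, Sum.elim_inr, LinearMap.coe_proj, Function.eval,
      Fin.prod_univ_three]
    have e0 : (Fin.castSucc (0 : Fin 3) : Fin 4) = 0 := rfl
    have e1 : (Fin.castSucc (1 : Fin 3) : Fin 4) = 1 := rfl
    have e2 : (Fin.castSucc (2 : Fin 3) : Fin 4) = 2 := rfl
    rw [e0, e1, e2]
    linear_combination h
  obtain ⟨t, -, ht⟩ := exists_forall_eq_zero_of_prod_eq_zero V f Finset.univ hprod
  -- the vanishing arm cell `e`
  obtain ⟨e, heV, he⟩ : ∃ e : Fin 4 × Fin 4, (∀ y ∈ V, y e = 0) ∧ (e.1 = 3 ∨ e.2 = 3) := by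
    rcases t with k | k
    · exact ⟨((3 : Fin 4), (Fin.castSucc k : Fin 4)), fun y hy => ht y hy, Or.inl rfl⟩
    · exact ⟨((Fin.castSucc k : Fin 4), (3 : Fin 4)), fun y hy => ht y hy, Or.inr rfl⟩
  -- `V` is the whole cross (dimension `7`), so it contains the unit matrix at `e`
  set T : Finset (Fin 4 × Fin 4) := Finset.univ.filter fun p : Fin 4 × Fin 4 => p.1 = 3 ∨ p.2 = 3
    with hTdef
  set C : Submodule K (Fin 4 × Fin 4 → K) :=
    Submodule.span K ↑(T.image fun p => (Pi.single p (1 : K) : Fin 4 × Fin 4 → K)) with hCdef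
  have hCle : finrank K C ≤ 7 := by
    rw [hCdef]
    exact (finrank_span_finset_le_card _).trans (Finset.card_image_le.trans (by rw [hTdef, crossCells_card]))
  have hVC : V ≤ C := by
    intro y hy
    have hy0 : ∀ p, p ∉ T → y p = 0 := by
      intro p hp
      rw [hTdef, Finset.mem_filter] at hp
      push Not at hp
      have hnc := hp (Finset.mem_univ _)
      exact hX y hy p.1 p.2 hnc.1 hnc.2
    have hdecomp : y = ∑ p ∈ T, y p • (Pi.single p (1 : K) : Fin 4 × Fin 4 → K) :=
      calc y = ∑ p, (Pi.single p (y p) : Fin 4 × Fin 4 → K) := (Finset.univ_sum_single y).symm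
        _ = ∑ p ∈ T, (Pi.single p (y p) : Fin 4 × Fin 4 → K) := by
          symm
          refine Finset.sum_subset (Finset.subset_univ T) fun p _ hp => ?_
          rw [hy0 p hp, Pi.single_zero]
        _ = ∑ p ∈ T, y p • (Pi.single p (1 : K) : Fin 4 × Fin 4 → K) :=
          Finset.sum_congr rfl fun p _ => by
            ext p'
            by_cases hp : p' = p
            · subst hp; simp
            · simp [hp]
    rw [hdecomp]
    exact Submodule.sum_mem _ fun p hp => Submodule.smul_mem _ _
      (Submodule.subset_span (Finset.mem_coe.2 (Finset.mem_image_of_mem _ hp)))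
  have hVeq : V = C := Submodule.eq_of_le_of_finrank_le hVC (hCle.trans h7.ge)
  have heT : e ∈ T := by rw [hTdef, Finset.mem_filter]; exact ⟨Finset.mem_univ _, he⟩
  have heC : (Pi.single e (1 : K) : Fin 4 × Fin 4 → K) ∈ V := by
    rw [hVeq, hCdef]
    exact Submodule.subset_span (Finset.mem_coe.2 (Finset.mem_image_of_mem _ heT))
  have := heV _ heC
  simp at this

/-- **A general cross `X_{lc}`** (transport by the swaps `3 ↔ l`, `3 ↔ c`). [folklore] -/
theorem false_of_cross_seven_of_sum_sq_swap [CharZero K] {ι : Type*} [Fintype ι]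
    (hι : Fintype.card ι < 9) (V : Submodule K (Fin 4 × Fin 4 → K)) {l c : Fin 4}
    (hX : ∀ x ∈ V, ∀ i j : Fin 4, i ≠ l → j ≠ c → x (i, j) = 0) (h7 : finrank K V = 7)
    (hW : ∀ y ∈ V, ∃ (c : ι → K) (Λ : ι → ((Fin 4 × Fin 4 → K) →ₗ[K] K)),
      ∀ u : Fin 4 × Fin 4 → K, ∃ e₀ e₁ : K, ∀ s : K,
        eval (u + s • y) (perPoly (Fin 4) K) = e₀ + s * e₁ + s ^ 2 * ∑ k, c k * (Λ k u) ^ 2) :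
    False := by
  set σ : Equiv.Perm (Fin 4) := Equiv.swap 3 l with hσ
  set τ : Equiv.Perm (Fin 4) := Equiv.swap 3 c with hτ
  set Φ : (Fin 4 × Fin 4 → K) ≃ₗ[K] (Fin 4 × Fin 4 → K) :=
    LinearEquiv.funCongrLeft K K (Equiv.prodCongr σ τ) with hΦ
  have hΦa : ∀ (x : Fin 4 × Fin 4 → K) (i j : Fin 4), Φ x (i, j) = x (σ i, τ j) := fun x i j => rfl
  have hW' := sqFamilySwap_map V Φ (fun z => eval_perPoly_comp_prodCongr σ τ z) hW
  set V' := V.map Φ.toLinearMap with hV'def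
  have hfin : finrank K V' = 7 := by rw [hV'def, LinearEquiv.finrank_map_eq, h7]
  have hX' : ∀ x ∈ V', ∀ i j : Fin 4, i ≠ 3 → j ≠ 3 → x (i, j) = 0 := by
    rintro _ ⟨x, hx, rfl⟩ i j hi hj
    show Φ x (i, j) = 0
    rw [hΦa]
    refine hX x hx (σ i) (τ j) (fun h => hi ?_) (fun h => hj ?_)
    · rw [hσ, Equiv.swap_apply_eq_iff, Equiv.swap_apply_right] at h; exact h
    · rw [hτ, Equiv.swap_apply_eq_iff, Equiv.swap_apply_right] at h; exact h
  exact false_of_cross33_seven_of_sum_sq_swap hι V' hX' hfin hW'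

/-- **The cross branch of the cell `(9,7,8)`**: a `7`-dimensional `V` inside a cross carries no
per-direction family of `8` squares (`Fin 8`). [folklore] -/
theorem not_sqFamilySwap_eight_of_cross_seven [CharZero K] (V : Submodule K (Fin 4 × Fin 4 → K))
    (hX : ∃ l c : Fin 4, ∀ x ∈ V, ∀ i j : Fin 4, i ≠ l → j ≠ c → x (i, j) = 0)
    (h7 : finrank K V = 7) :
    ¬ (∀ y ∈ V, ∃ (c : Fin 8 → K) (Λ : Fin 8 → ((Fin 4 × Fin 4 → K) →ₗ[K] K)),
      ∀ u : Fin 4 × Fin 4 → K, ∃ e₀ e₁ : K, ∀ s : K,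
        eval (u + s • y) (perPoly (Fin 4) K) = e₀ + s * e₁ + s ^ 2 * ∑ k, c k * (Λ k u) ^ 2) := by
  intro hW
  obtain ⟨l, c, hX⟩ := hX
  exact false_of_cross_seven_of_sum_sq_swap (ι := Fin 8) (by simp) V hX h7 hW

end Summit.ValiantsHypothesis.ValiantsHypothesis.Theorems.SymPencilPerFourCrossSevenEight

end
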